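import Summits.HodgeConjecture.CorCM.GaloisTwoPeriodicSheets
import HarnessLib

/-!
# `Γ₀ × C₂` is BAD as soon as the abelian index-two subgroup `A₀ ∋ c` is not a cyclic `2`-group (`|A₀| > 4`) — hard side included

COR-CM (cell `pub-hodgecm2`), binder seat b04 (gen 30), count-neutral own lane «Galois-CM-type classification» (which Galois CM
fields `(G, c)` have ALL primitive CM types nondegenerate = GOOD, vs. a primitive degenerate type = BAD).  KERNEL ONLY: theorems;
no definition, no named fact, no `sorry`.  `HC_CM` is neither used nor claimed.

THE QUESTION.  Gen 24's REAL-FACTOR theorem (`CorCM/GaloisRealFactorDegenerate`) makes `Γ × H` BAD for every totally real Galois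
factor `H ∉ {1, C₂, C₂², C₂³, C₄, C_p, S₃}`; for `H = C_p, C₄` the EASY side of the index-two dichotomy is BAD for all `Γ₀`
(`CorCM/GaloisIndexTwoTimesCyclicAllDegrees`).  The factor `H = C₂` is genuinely exceptional: `Q₈ × C₂`, `Q₁₆ × C₂`, `D₄ × C₂`
(`c` in the first factor) are GOOD, `D₈ × C₂`, `Q₈ × C₂²`, Pauli `× C₂`, `Dic₃ × C₂` are BAD (order-32 census, gen 20 order 24).

THEOREM (§2 **`exists_simple_degenerate_of_index_two_times_two`**).  `K` Galois CM, `e : Gal(K/ℚ) ≃* G₀`,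
`i : A₀ × C₂ ↪ G₀` abelian of index two (`G₀ = i(A) ⊔ i(A)x`), `x i(a, v) x⁻¹ = i(θ₀ a, v)`, `x² = i(q)` for ANY `q` (easy or
hard side), complex conjugation `e(c̄) = i(c, 1)`.  If **`|A₀| > 4` and some `u ∈ A₀`, `u ≠ 1`, has `c ∉ ⟨u⟩`** — i.e. `A₀` is
not a cyclic `2`-group and not `C₂²` — then `K` is BAD: a PRIMITIVE DEGENERATE CM type, realised by a SIMPLE abelian variety of
dimension `|G₀|/2` with CM by `K` (rational `(p,p)` class outside the divisor ring on some power).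
PROOF = the two-periodic-sheets criterion (`CorCM/GaloisTwoPeriodicSheets`) with `S₀ = S̄₀ × C₂`, `S̄₀` a `u`-periodic half of
`A₀` (pull-back of a half of `A₀/⟨u⟩`, §1 `exists_periodic_half`), `S₁ = {(a, v) : a cᵛ ∈ H̄}`, `H̄` an APERIODIC half of `A₀`
(§1 `exists_aperiodic_half`: exists iff `|A₀| > 4` — if every half had a period `s`, flipping at `{1, c}` gives a half whose
periods lie in `{s⁻¹, s⁻¹c}`, and both are absurd), periods `u₀ = (u, 1)`, `u₁ = (c, t)`, and an odd character `χ = χ₀ ∘ pr₁` with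
`χ₀(u) ≠ 1` (§1 `exists_odd_character_ne_one`): `Ŝ₀(χ) = Ŝ₁(χ) = 0`; a common period `(α, ε)` forces `αcᵋ ∈ Stab(H̄) = 1`,
then `ε = t`, `α = c`, but `c` is never a period of `S̄₀`; and `a·θ(S₀) = S₁` would make `S₁` invariant under `(1, t)`, i.e. `H̄`
invariant under `c`.

COROLLARIES (`CorCM/GaloisDicyclicTimesTwoDegenerate`).  **`Dic_m × C₂` (`c = aᵐ`) is BAD for every `m` that is NOT a power
of two** (`A₀ = ℤ/2m`, `u = 2^{k+1}` for `m = 2^k m'`, `m' > 1` odd) — with gen 20 (`Q_{2^{k+2}} × C₂` GOOD) an IFF: `Dic_m × C₂`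
is GOOD ⟺ `m` is a power of `2`.  Further instances (same theorem, other presentations): `(C_p ⋊ C₈) × C₂` (`A₀ = C₄ × C_p`,
`u ∈ C_p`) — BAD although `C_p ⋊ C₈` is GOOD for `p ≡ 5 (mod 8)`; Pauli `× C₂`, `Q₈ × C₂²`, `D₄ × C₂²` (order-32 census rows);
consistent with the GOOD `Q₈ × C₂`, `Q₁₆ × C₂`, `D₄ × C₂` (`A₀` cyclic `2`-group or `C₂²`).

## References

* [Kubota1965] T. Kubota, *On the field extension by complex multiplication*, Trans. AMS 118 (1965), §2, §4 Lemma 2.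
* [Shimura1998] G. Shimura, *Abelian Varieties with Complex Multiplication and Modular Functions*, §6.2 Thm. 3, §8.2 Prop. 26.
* [Gordon1999HodgeAVSurvey] B. B. Gordon, *A survey of the Hodge conjecture for abelian varieties*, Thm. 6.4, §9.3.
-/

noncomputable section

open CategoryTheory CategoryTheory.Limits NumberField
open scoped BigOperators symmDiff

namespace Summit.HodgeConjecture.CorCM.SplitInvolution

open Literature.NumberTheory.ComplexMultiplication
open Literature.AlgebraicGeometry.Motives (AbelianVariety CMType)
open Literature.AlgebraicGeometry.HodgeTheory
open Literature.AlgebraicGeometry.ComplexMultiplication (IsCMTypeRealisation)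
open Literature.AlgebraicGeometry.Pohlmann1968
open Literature.Barriers.HodgeConjecture (divisorClassesSpan)
open Summit.HodgeConjecture.CorCM.GaloisRank (model_complexConj_mul_self model_complexConj_comm)

/-! ## §1 Halves of a finite abelian group: existence, periodic halves, aperiodic halves, separating odd characters -/

section Halves

variable {A₀ : Type*} [CommGroup A₀] [Fintype A₀] [DecidableEq A₀]

omit [DecidableEq A₀] in
/-- A CM half of `(A₀, c)` exists (`c ≠ 1`, `c² = 1`): `{b : f b < f (c b)}` for a bijection `f : A₀ ≃ Fin N`. [folklore] -/
theorem exists_half_mul (c : A₀) (hc1 : c ≠ 1) (hcc : c * c = 1) : ∃ H : Finset A₀, ∀ b, b ∈ H ↔ c * b ∉ H := by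
  classical
  let f := Fintype.equivFin A₀
  refine ⟨Finset.univ.filter fun b => f b < f (c * b), fun b => ?_⟩
  have hcb : c * (c * b) = b := by rw [← mul_assoc, hcc, one_mul]
  have hne : f (c * b) ≠ f b := fun h => hc1 (by simpa using f.injective h)
  simp only [Finset.mem_filter, Finset.mem_univ, true_and, hcb, not_lt]
  exact ⟨fun h => h.le, fun h => lt_of_le_of_ne h hne.symm⟩

omit [DecidableEq A₀] in
/-- **A `u`-PERIODIC half** (`c ∉ ⟨u⟩`): pull back a half of `A₀/⟨u⟩` (there `c̄ ≠ 1`, `c̄² = 1`). [folklore] -/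
theorem exists_periodic_half (c u : A₀) (hcc : c * c = 1) (hcu : c ∉ Subgroup.zpowers u) :
    ∃ H : Finset A₀, (∀ b, b ∈ H ↔ c * b ∉ H) ∧ ∀ b, b ∈ H ↔ u * b ∈ H := by
  classical
  let π : A₀ →* A₀ ⧸ Subgroup.zpowers u := QuotientGroup.mk' (Subgroup.zpowers u)
  have hc1 : π c ≠ 1 := fun h => hcu ((QuotientGroup.eq_one_iff c).1 h)
  have hcc' : π c * π c = 1 := by rw [← map_mul, hcc, map_one]
  have hu1 : π u = 1 := (QuotientGroup.eq_one_iff u).2 (Subgroup.mem_zpowers u)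
  haveI : Fintype (A₀ ⧸ Subgroup.zpowers u) := Fintype.ofFinite _
  obtain ⟨HQ, hHQ⟩ := exists_half_mul (π c) hc1 hcc'
  refine ⟨Finset.univ.filter fun b => π b ∈ HQ, fun b => ?_, fun b => ?_⟩
  · simp only [Finset.mem_filter, Finset.mem_univ, true_and, map_mul]
    exact hHQ (π b)
  · simp only [Finset.mem_filter, Finset.mem_univ, true_and, map_mul, hu1, one_mul]

omit [Fintype A₀] in
/-- Flipping a half along the coset `{b₀, c b₀}` gives a half. [folklore] -/
theorem flip_cm_mul (H : Finset A₀) (c : A₀) (hcc : c * c = 1) (hH : ∀ b, b ∈ H ↔ c * b ∉ H) (b₀ b : A₀) :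
    b ∈ H ∆ {b₀, c * b₀} ↔ c * b ∉ H ∆ {b₀, c * b₀} := by
  have hcb : ∀ b, c * (c * b) = b := fun b => by rw [← mul_assoc, hcc, one_mul]
  have key : (c * b = b₀ ∨ c * b = c * b₀) ↔ (b = b₀ ∨ b = c * b₀) := by
    constructor
    · rintro (h | h)
      · right; rw [← h, hcb]
      · left; exact mul_left_cancel h
    · rintro (h | h)
      · right; rw [h]
      · left; rw [h, hcb]
  have h2 : c * b ∈ H ↔ b ∉ H := by rw [hH (c * b), hcb]
  simp only [Finset.mem_symmDiff, Finset.mem_insert, Finset.mem_singleton, key, h2]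
  tauto

/-- **An APERIODIC half exists as soon as `|A₀| > 4`** (`c ≠ 1`, `c² = 1`).  If every half had a non-trivial period: take a half
`H` with period `s` and its flip `H' = H Δ {1, c}` with period `a`; `s`-invariance of the defect set `{1, c, a⁻¹, a⁻¹c}` of `a` on
`H` gives `as ∈ {1, c}`; `a = s⁻¹` is a common period of `H, H'` (absurd at `1`), and `a = s⁻¹c` turns `H'`-periodicity into
`A₀ = {1, c} ⊔ {a⁻¹, a⁻¹c}`. [folklore] -/
theorem exists_aperiodic_half (c : A₀) (hc1 : c ≠ 1) (hcc : c * c = 1) (hcard : 4 < Fintype.card A₀) :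
    ∃ H : Finset A₀, (∀ b, b ∈ H ↔ c * b ∉ H) ∧ ∀ s : A₀, s ≠ 1 → ∃ b, ¬ (b ∈ H ↔ s * b ∈ H) := by
  classical
  by_contra hall
  push Not at hall
  obtain ⟨H, hH⟩ := exists_half_mul c hc1 hcc
  obtain ⟨s, hs1, hs⟩ := hall H hH
  have hH' := flip_cm_mul H c hcc hH 1
  rw [mul_one] at hH'
  obtain ⟨a, ha1, ha⟩ := hall (H ∆ {1, c}) hH'
  have hcinv : c⁻¹ = c := inv_eq_of_mul_eq_one_right hcc
  -- no half is `c`-periodic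
  have hsc : s ≠ c := by
    rintro rfl
    exact iff_not_self ((hs 1).symm.trans (hH 1))
  have hac : a ≠ c := by
    rintro rfl
    exact iff_not_self ((ha 1).symm.trans (hH' 1))
  have hmemD : ∀ y, y ∈ H ∆ {1, c} ↔ (y ∈ H ∧ ¬ (y = 1 ∨ y = c) ∨ (y = 1 ∨ y = c) ∧ y ∉ H) := fun y => by
    rw [Finset.mem_symmDiff, Finset.mem_insert, Finset.mem_singleton]
  -- `1` is a defect of `a` on `H`: `¬ (1 ∈ H ↔ a ∈ H)`
  have h1D : ¬ (1 ∈ H ↔ a ∈ H) := by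
    have e1 := ha 1
    simp only [mul_one, hmemD, true_or, not_true_eq_false, and_false, false_or, true_and, ha1, hac,
      or_self, not_false_eq_true, and_true, false_and, or_false] at e1
    tauto
  -- hence so is `s` (the defect set is `s`-invariant): `¬ (s ∈ H ↔ a s ∈ H)`
  have hsD : ¬ (s ∈ H ↔ a * s ∈ H) := by
    have e1 := hs 1
    rw [mul_one] at e1
    have e2 := hs a
    rw [mul_comm s a] at e2
    rwa [← e1, ← e2]
  -- and `H'`-periodicity at `s` gives `a s ∈ {1, c}`
  have has : a * s = 1 ∨ a * s = c := by
    have e1 := ha s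
    simp only [hmemD, hs1, hsc, or_self, not_false_eq_true, and_true, false_and, or_false] at e1
    tauto
  rcases has with has | has
  · -- `a = s⁻¹` is a period of `H` as well: contradiction at `1`
    have haH : ∀ y, y ∈ H ↔ a * y ∈ H := fun y => by
      have e := hs (a * y)
      rw [← mul_assoc, mul_comm s a, has, one_mul] at e
      exact e.symm
    have e3 := haH 1
    rw [mul_one] at e3
    exact h1D e3
  · -- `a = s⁻¹ c`: `a y ∈ H ↔ y ∉ H`, so `H'`-periodicity says `y ∈ {1,c} ↔ a y ∉ {1,c}`: `|A₀| ≤ 4`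
    have haH : ∀ y, a * y ∈ H ↔ y ∉ H := fun y => by
      have e := hs (a * y)
      rw [← mul_assoc, mul_comm s a, has] at e
      rw [e, hH y, not_not]
    have hcov : ∀ y : A₀, (y = 1 ∨ y = c) ∨ (a * y = 1 ∨ a * y = c) := fun y => by
      have e1 := ha y
      rw [hmemD, hmemD, haH y] at e1
      tauto
    have hsub : (Finset.univ : Finset A₀) ⊆ {1, c, a⁻¹, a⁻¹ * c} := by
      intro y _
      simp only [Finset.mem_insert, Finset.mem_singleton]
      rcases hcov y with (h | h) | (h | h)
      · exact Or.inl h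
      · exact Or.inr (Or.inl h)
      · exact Or.inr (Or.inr (Or.inl (eq_inv_of_mul_eq_one_right h)))
      · exact Or.inr (Or.inr (Or.inr (by rw [← h, ← mul_assoc, inv_mul_cancel, one_mul])))
    have hle : Fintype.card A₀ ≤ 4 := by
      rw [← Finset.card_univ]
      refine (Finset.card_le_card hsub).trans ?_
      have : ({1, c, a⁻¹, a⁻¹ * c} : Finset A₀) = ([1, c, a⁻¹, a⁻¹ * c] : List A₀).toFinset := by simp
      rw [this]
      exact (List.toFinset_card_le _).trans (by simp)
    omega

omit [DecidableEq A₀] in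
/-- **An odd character that sees `u ≠ 1`**: `c ≠ 1`, `c² = 1`, `u ≠ 1` ⟹ some `χ` with `χ(c) = −1` and `χ(u) ≠ 1` (characters
separate points; multiply an odd character by an even one seeing `u` if necessary). [folklore] -/
theorem exists_odd_character_ne_one {c u : A₀} (hc1 : c ≠ 1) (hcc : c * c = 1) (hu : u ≠ 1) :
    ∃ χ : AddChar (Additive A₀) ℂ, χ (Additive.ofMul c) = -1 ∧ χ (Additive.ofMul u) ≠ 1 := by
  classical
  obtain ⟨χ₁, hχ₁⟩ := exists_odd_character hc1 hcc
  by_cases h1 : χ₁ (Additive.ofMul u) = 1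
  · -- a character seeing `u`
    have hu0 : Additive.ofMul u ≠ 0 := fun h => hu (by simpa using congrArg Additive.toMul h)
    have hsum : ∑ ψ : AddChar (Additive A₀) ℂ, ψ (Additive.ofMul u) = 0 := AddChar.sum_apply_eq_zero_iff_ne_zero.2 hu0
    obtain ⟨ψ, hψ⟩ : ∃ ψ : AddChar (Additive A₀) ℂ, ψ (Additive.ofMul u) ≠ 1 := by
      by_contra hall
      push Not at hall
      simp only [hall, Finset.sum_const, Finset.card_univ, nsmul_eq_mul, mul_one] at hsum
      exact Nat.cast_ne_zero.2 Fintype.card_ne_zero hsum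
    rcases TwoSheet.character_involution ψ hcc with hψc | hψc
    · refine ⟨χ₁ * ψ, ?_, ?_⟩
      · rw [AddChar.mul_apply, hχ₁, hψc, mul_one]
      · rw [AddChar.mul_apply, h1, one_mul]; exact hψ
    · exact ⟨ψ, hψc, hψ⟩
  · exact ⟨χ₁, hχ₁, h1⟩

end Halves

/-! ## §2 The theorem: `Γ₀ × C₂` with `A₀` not a cyclic `2`-group (`|A₀| > 4`) is BAD -/

section Field

variable {G₀ : Type*} [Group G₀] [Fintype G₀] [DecidableEq G₀]
variable {A₀ : Type*} [CommGroup A₀] [Fintype A₀] [DecidableEq A₀]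
variable {K : Type} [Field K] [NumberField K] [IsCMField K] [IsGalois ℚ K]

/-- **`× C₂` IS FATAL UNLESS `A₀` IS A CYCLIC `2`-GROUP.**  `K` Galois CM, `e : Gal(K/ℚ) ≃* G₀`; `i : A₀ × C₂ ↪ G₀` abelian of
index two (`G₀ = i(A) ⊔ i(A)x`), `x i(a, v) = i(θ₀ a, v) x`, `x² = i(q)` for ANY `q`; complex conjugation `e(c̄) = i(c, 1)`.  If
`|A₀| > 4` and some `u ≠ 1` of `A₀` has `c ∉ ⟨u⟩`, THEN `K` has a PRIMITIVE DEGENERATE CM type, realised by a SIMPLE abelian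
variety of dimension `|G₀|/2` with CM by `K` carrying a rational `(p,p)` class outside the divisor ring on some power.
[cite: Kubota1965, §2 and §4 Lemma 2] [cite: Shimura1998, §6.2 Thm. 3 and §8.2 Prop. 26] [cite: Gordon1999HodgeAVSurvey, Thm. 6.4 and §9.3] -/
theorem exists_simple_degenerate_of_index_two_times_two (e : (K ≃ₐ[ℚ] K) ≃* G₀)
    (i : A₀ × Multiplicative (ZMod 2) →* G₀) (hi : Function.Injective i) (x : G₀) (hx : ∀ w, i w ≠ x)
    (hcov : ∀ g : G₀, (∃ w, g = i w) ∨ (∃ w, g = i w * x)) (θ₀ : A₀ ≃* A₀)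
    (hθ : ∀ (a : A₀) (v : Multiplicative (ZMod 2)), x * i (a, v) = i (θ₀ a, v) * x)
    (q : A₀ × Multiplicative (ZMod 2)) (hq : x * x = i q) (c : A₀)
    (hc : e ((IsCMField.complexConj K).restrictScalars ℚ) = i (c, 1)) (u : A₀) (hu : u ≠ 1)
    (hcu : c ∉ Subgroup.zpowers u) (hcard : 4 < Fintype.card A₀) :
    ∃ (Φ : CMType K) (φ₀ : K →+* ℂ) (X : AbelianVariety ℂ) (ι : 𝓞 K →+* End X)
      (ϑ : K →+* Module.End ℂ (complexBetti X.X 1)),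
      IsPrimitive (ℂ ≃+* ℂ) Φ.1 φ₀ ∧ ¬ IsNondegenerate Φ ∧ IsCMTypeRealisation Φ X ι ϑ ∧ X.IsSimple ∧
      X.dim = Fintype.card G₀ / 2 ∧
      ∃ n p : ℕ, ∃ y : complexBetti (⨁ fun _ : Fin n => X).X (2 * p), IsRationalClass y ∧
        IsOfHodgeType (⨁ fun _ : Fin n => X).dim (⨁ fun _ : Fin n => X).X (2 * p) p p y ∧
        y ∉ divisorClassesSpan (⨁ fun _ : Fin n => X).X (⨁ fun _ : Fin n => X).dim p := by
  classical
  -- `c² = 1`, `c ≠ 1`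
  have hccA : ((c, 1) : A₀ × Multiplicative (ZMod 2)) * (c, 1) = 1 :=
    hi (by rw [map_mul, map_one]; exact model_complexConj_mul_self e hc)
  have hcc : c * c = 1 := by simpa using congrArg Prod.fst hccA
  have hc1 : c ≠ 1 := by
    rintro rfl
    exact hcu (one_mem _)
  have hcinv : c⁻¹ = c := inv_eq_of_mul_eq_one_right hcc
  have z01 : ∀ v : Multiplicative (ZMod 2), v = 1 ∨ v = Multiplicative.ofAdd 1 := by decide
  have ztt : Multiplicative.ofAdd (1 : ZMod 2) * Multiplicative.ofAdd 1 = 1 := by decide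
  have zt1 : Multiplicative.ofAdd (1 : ZMod 2) ≠ 1 := by decide
  -- the data of the criterion
  let θ : A₀ × Multiplicative (ZMod 2) ≃* A₀ × Multiplicative (ZMod 2) := MulEquiv.prodCongr θ₀ (MulEquiv.refl _)
  have hθ_apply : ∀ w, θ w = (θ₀ w.1, w.2) := fun w => rfl
  have hθ' : ∀ w, x * i w = i (θ w) * x := fun ⟨a, v⟩ => hθ a v
  obtain ⟨S, hS, hSu⟩ := exists_periodic_half c u hcc hcu
  obtain ⟨H, hH, hHap⟩ := exists_aperiodic_half c hc1 hcc hcard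
  obtain ⟨χ₀, hχ₀c, hχ₀u⟩ := exists_odd_character_ne_one hc1 hcc hu
  -- the sheets `S₀ = S × C₂`, `S₁ = {(a, v) : a cᵛ ∈ H}`
  set S₀ : Finset (A₀ × Multiplicative (ZMod 2)) := Finset.univ.filter fun w => w.1 ∈ S with hS₀_def
  set S₁ : Finset (A₀ × Multiplicative (ZMod 2)) :=
    Finset.univ.filter fun w => (if w.2 = 1 then w.1 else c * w.1) ∈ H with hS₁_def
  have hS₀m : ∀ (a : A₀) (v : Multiplicative (ZMod 2)), (a, v) ∈ S₀ ↔ a ∈ S := fun a v => by simp [hS₀_def]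
  have hS₁one : ∀ a : A₀, (a, (1 : Multiplicative (ZMod 2))) ∈ S₁ ↔ a ∈ H := fun a => by simp [hS₁_def]
  have hS₁t : ∀ a : A₀, (a, Multiplicative.ofAdd (1 : ZMod 2)) ∈ S₁ ↔ c * a ∈ H := fun a => by simp [hS₁_def, zt1]
  have hS₀ : ∀ w, w ∈ S₀ ↔ ((c, 1) : A₀ × Multiplicative (ZMod 2)) * w ∉ S₀ := fun ⟨a, v⟩ => by
    rw [Prod.mk_mul_mk, hS₀m, hS₀m]
    exact hS a
  have hS₁ : ∀ w, w ∈ S₁ ↔ ((c, 1) : A₀ × Multiplicative (ZMod 2)) * w ∉ S₁ := fun ⟨a, v⟩ => by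
    rw [Prod.mk_mul_mk, one_mul]
    rcases z01 v with rfl | rfl
    · rw [hS₁one, hS₁one]; exact hH a
    · rw [hS₁t, hS₁t]; exact hH (c * a)
  -- the periods
  have hu₀ : ∀ w, w ∈ S₀ ↔ ((u, 1) : A₀ × Multiplicative (ZMod 2)) * w ∈ S₀ := fun ⟨a, v⟩ => by
    rw [Prod.mk_mul_mk, hS₀m, hS₀m]
    exact hSu a
  have hu₁ : ∀ w, w ∈ S₁ ↔ ((c, Multiplicative.ofAdd 1) : A₀ × Multiplicative (ZMod 2)) * w ∈ S₁ := fun ⟨a, v⟩ => by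
    rw [Prod.mk_mul_mk]
    rcases z01 v with rfl | rfl
    · rw [mul_one, hS₁one, hS₁t, ← mul_assoc, hcc, one_mul]
    · rw [ztt, hS₁t, hS₁one]
  -- the character `χ = χ₀ ∘ pr₁`
  let φ : Additive (A₀ × Multiplicative (ZMod 2)) →+ Additive A₀ :=
    { toFun := fun z => Additive.ofMul (Additive.toMul z).1
      map_zero' := rfl
      map_add' := fun _ _ => rfl }
  let χ : AddChar (Additive (A₀ × Multiplicative (ZMod 2))) ℂ := χ₀.compAddMonoidHom φ
  have hχ_apply : ∀ (a : A₀) (v : Multiplicative (ZMod 2)), χ (Additive.ofMul (a, v)) = χ₀ (Additive.ofMul a) :=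
    fun a v => rfl
  have hχ : χ (Additive.ofMul ((c, 1) : A₀ × Multiplicative (ZMod 2))) = -1 := by rw [hχ_apply, hχ₀c]
  have hχ₀' : χ (Additive.ofMul ((u, 1) : A₀ × Multiplicative (ZMod 2))) ≠ 1 := by rw [hχ_apply]; exact hχ₀u
  have hχ₁' : χ (Additive.ofMul ((c, Multiplicative.ofAdd 1) : A₀ × Multiplicative (ZMod 2))) ≠ 1 := by
    rw [hχ_apply, hχ₀c]; norm_num
  -- joint primitivity: no common period
  have hper : ∀ w : A₀ × Multiplicative (ZMod 2), w ≠ 1 →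
      (∃ s, ¬ (s ∈ S₀ ↔ w * s ∈ S₀)) ∨ (∃ s, ¬ (s ∈ S₁ ↔ w * s ∈ S₁)) := by
    rintro ⟨α, ε⟩ hne
    by_contra hcon
    push Not at hcon
    obtain ⟨h0, h1⟩ := hcon
    rcases z01 ε with rfl | rfl
    · -- `ε = 1`: `α` is a period of `H`, so `α = 1`
      have hα : α ≠ 1 := fun h => hne (by rw [h]; rfl)
      obtain ⟨b, hb⟩ := hHap α hα
      apply hb
      have e := h1 (b, 1)
      rwa [Prod.mk_mul_mk, mul_one, hS₁one, hS₁one] at e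
    · -- `ε = t`: `c α` is a period of `H`, so `α = c` — but `c` is no period of `S`
      by_cases hα : c * α = 1
      · have hαc : α = c := by rw [← hcinv]; exact (eq_inv_of_mul_eq_one_right hα)
        have e := h0 (1, 1)
        rw [Prod.mk_mul_mk, mul_one, hS₀m, hS₀m, hαc] at e
        have e3 := hS 1
        rw [mul_one] at e3
        exact iff_not_self (e.symm.trans e3)
      · obtain ⟨b, hb⟩ := hHap (c * α) hα
        apply hb
        have e := h1 (b, 1)
        rwa [Prod.mk_mul_mk, mul_one, hS₁one, hS₁t, ← mul_assoc] at e
  -- joint primitivity: `a·θ(S₀) ≠ S₁`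
  have hrefl : ∀ w : A₀ × Multiplicative (ZMod 2),
      (∃ s, ¬ (s ∈ S₀ ↔ w * θ s ∈ S₁)) ∨ (∃ s, ¬ (s ∈ S₁ ↔ w * θ s * q ∈ S₀)) := by
    rintro ⟨α, ε⟩
    left
    by_contra hcon
    push Not at hcon
    have e1 := hcon (1, 1)
    have e2 := hcon (1, Multiplicative.ofAdd 1)
    have hθ1 : θ (1, 1) = (1, 1) := by rw [hθ_apply]; simp
    have hθ2 : θ (1, Multiplicative.ofAdd 1) = (1, Multiplicative.ofAdd 1) := by rw [hθ_apply]; simp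
    rw [hθ1, Prod.mk_mul_mk, mul_one, mul_one, hS₀m] at e1
    rw [hθ2, Prod.mk_mul_mk, mul_one, hS₀m] at e2
    have h3 := hH α
    rcases z01 ε with rfl | rfl
    · rw [hS₁one] at e1
      rw [one_mul, hS₁t] at e2
      tauto
    · rw [hS₁t] at e1
      rw [ztt, hS₁one] at e2
      tauto
  exact exists_simple_degenerate_of_periodic_sheets e i hi x hx hcov θ hθ' q hq hc S₀ S₁ hS₀ hS₁ (u, 1)
    (c, Multiplicative.ofAdd 1) hu₀ hu₁ χ hχ hχ₀' hχ₁' hper hrefl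

end Field

end Summit.HodgeConjecture.CorCM.SplitInvolution

end
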